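import Literature.MathematicalPhysics.QuantumFieldTheory.Balaban1983to89.B8LeafKnitZd3OfThm4

/-!
# `Balaban1983to89.B8LeafModelZd3Map` — [Balaban1985RegularSpaces] PROPOSITION 3 (p. 87) AND THEOREM 2 (p. 83) ON AN INDEX-MAPPED
# SUB-FAMILY OF THE PROTOTYPE `zdGF3` (generic over `ι : J → ZdIdx d L`; the printed sentences entered as hypotheses where possible)

statement-level skeleton of published theorems with citation tags; proofs where landed; nothing here is a claim about the
Yang–Mills mass gap

PDF held: `paper:balaban1985-cmp99-regular-spaces-gauge-fixing` (journal page = PDF page + 74); pp. 83, 87–88.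

WHY THIS FILE (cell `pub-ymgap`, seat `pub-ymgap-dag-n05-a` g7, socket owner of the N05 knit; INTERFACE ASK of `pub-ymgap-dag-n05-d` g0,
2026-08-26: «state the chain PREDICATE-GENERIC»).  The prototype theorems of record quantify their sockets over EVERY `i : ZdIdx d L` and
conclude over the whole index (Theorem 4, Proposition 3) or over `{i // i.Ω 0 = univ}` (Theorem 2, the knit).  The located typing
constraint of n05-d (`B8SockHFPOfSockLetters`, LOCATED-1): a Proposition-5 provider serves the fixed-point sockets only at members carrying
two extra laws (towers inside `Ω_j` at every truncation; the index law №8), so the letters-fed knit lives on a SUB-FAMILY — and a theorem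
whose sockets range over all of `ZdIdx d L` cannot be fed there.  This file restates the pointwise content GENERICALLY over an index map
`ι : J → ZdIdx d L` (family `fun j => zdGF3 𝔸 L β len (ι j)`; the predicate form is `J := {i // P i}`, `ι := Subtype.val`; the
statements of record are `ι := id` / `ι := Subtype.val` on `{i // i.Ω 0 = univ}`): Proposition 3 with its b9 socket at ONE member
(`prop3Body_member_zd3`, threshold chosen before the member) and on `fam₂ ∘ ι` (`prop3Printed_zd3_map`); Theorem 2 ((1.66)₁-typed) on
`fam ∘ ι` from `B8.Thm4Printed (fam₃ ∘ ι)` and `B8.Prop3Printed (fam₂ ∘ ι)` as hypotheses (`thm2Printed_zd3_map_of_thm4`); Theorem 2 as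
printed on `fam ∘ ι` from `B8.Thm2Printed (fam ∘ ι)` (`thm2_of135_zd3_map_of_thm2`).  The proofs are the landed ones VERBATIM with the
index bookkeeping changed (`i.1 ↦ ι i`, `i.2 ↦ hΩ i`, the first `obtain` reading the hypothesis); Theorem 4's generic instance (which
needs the repaired uniqueness socket) is in `B8LeafKnitZd3E`.

WHAT THIS FILE PROVES (kernel, 0 sorry, theorems only): `prop3Body_member_zd3`, `prop3Printed_zd3_map`, `thm2Printed_zd3_map_of_thm4`,
`thm2_of135_zd3_map_of_thm2`.

HONEST SCOPE.  Bookkeeping BY NAME over the landed assemblies (n05-b's `B8Prop3KLevel`, n11-b's `thm2_pointwise_A`, the (1.42) lemmas,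
`B8Ineq166Univ`, `B8LeafModelZd3Ineq165`); nothing of Propositions 3/5, Theorems 2/4, [4] is proved beyond them; the prototype's declared
readings (`B8LeafModelZd3` docstring) apply.  Count-neutral; N05 NOT discharged; nothing continuum / ℝ⁴ / OS / mass-gap / Clay.  Unit
`pub-ymgap-dag-n05-a` (g7), 2026-08-26.
-/

noncomputable section

open NormedSpace

namespace Literature.MathematicalPhysics.QuantumFieldTheory.Balaban1983to89.B8LeafModelZd3Map

open Complex (I)
open MatrixLog B7Prop1Explicit B7Prop2Explicit B7Prop1Local B7Eq92Concrete
open B7Prop2Explicit (C0 c2')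
open B7Prop3Flat (c3)
open B8Ineq132 (covDerivFwd InAk BondTouches Under)
open B8Eq119TwistedAxial (Restr129 InAx)
open B8Eq184Proof (gaugeExp cfgExp)
open B8Lemma1NonAbelian (mulCfg)
open B8Eq140Level (SideTouches)
open B8Eq146AExpansion (iEta expCfg plaqCovDeriv)
open B8Eq143PlaqExpansion (pdiv)
open B7Prop4GeneralLevels (logCovIter linCovIter)
open B8Eq155JBound (Jcur wsup)
open B8ScaledSupNorm (bondNorm msup weight Bdd)
open B8Thm2LogB (blockTop)
open B8Ineq130 (tlo thi)
open B8Eq138LandauZd (IsLandau138W logCfg covLap)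
open B8Prop3GaugeFixedKLevel (mem_unitaryUnits_of_mgauge_eq mulCfg_eq_gaugeAct_of_mgauge_eq inAk_congr_of_sideTouches
  expCfg_iEta_eq_cfgExp cfgExp_congr_at)
open B9Eq340HolderZd (hquot AdmPair)
open B8Thm4AtLandau138 (mgauge_mgauge_inv)
open B8Thm4Windows (thm4_windows thm4_windows_extra)
open B8LeafModelZd (ZdIdx)
open B8LeafModelZd3 (mlogCfg mlogCfg_spec mlogCfg_of_sideTouches mlogCfg_of_not zdGF3 SockB9P3 prop3_windows)
open B8Ineq166Univ (norm_pert_sub_one_le_univ)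
open B8LeafModelZd3Ineq165 (avgClose_zdGF3_of135)
open B8Eq142KLevelTouching (H42_of_inAx_touching)

-- `Site` alone could resolve to the torus sites of `Setup.lean`; re-export the `ℤ^d` sites of `B7Prop1Explicit`.
export B7Prop1Explicit (Site)

variable {d : ℕ}

/-! ## §1 Proposition 3 at ONE member, socket inside; Proposition 3 on an index-mapped sub-family -/

section Prop3

variable {𝔸 : Type} [CStarAlgebra 𝔸] [Nontrivial 𝔸]

/-- **`B8.Prop3Body` AT ONE MEMBER of `zdGF3`, SOCKET INSIDE** (Proposition 3, p. 87): the assembly of `B8LeafModelZd3.prop3Printed_zd3`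
with ONE threshold `c = min cP cN(d, L, B₀)` chosen BEFORE the member, and the Prop.-3-frame b9 socket `SockB9P3` required AT THAT MEMBER
only (so a sub-family / an index map gets Proposition 3 from sockets on its image: `prop3Printed_zd3_map`).  Proof = the landed one verbatim.
[cite: Balaban1985RegularSpaces, Prop. 3 p.87, (1.40)–(1.42) p.83, (1.59)–(1.62) pp.86–87, (1.36)–(1.39) p.82] -/
theorem prop3Body_member_zd3 (hd2 : 2 ≤ d) {L : ℕ} (hL : 2 ≤ L) (inp : B8.B9Inputs) {B₀β C₂ cP : ℝ} (hB₀β : 0 ≤ B₀β)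
    (hC₂ : 2097152 * ((d : ℝ) + 1) ^ 2 ≤ C₂) (hcP : 0 < cP) (β : ℝ) (len : Site d → ℝ) :
    ∃ c : ℝ, 0 < c ∧ ∀ i : ZdIdx d L, SockB9P3 (𝔸 := 𝔸) L inp.B₀ B₀β cP β len i.η i.k i.Ω i.Λs i.Λb →
      B8.Prop3Body c d (L : ℝ) C₂ inp B₀β (fun _ : Unit => (zdGF3 𝔸 L β len i).toGFData2) := by
  have hL1 : 1 ≤ L := le_trans (by norm_num) hL
  have hLr : (1 : ℝ) ≤ L := by exact_mod_cast hL1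
  have hB₀ : 0 ≤ inp.B₀ := inp.B₀_pos.le
  obtain ⟨cN, hcN, hwin⟩ := prop3_windows hd2 hL hB₀
  refine ⟨min cP cN, lt_min hcP hcN, ?_⟩
  intro i SB9 _ α₀ α₁ α₂ hα₀ hα₀c hα₁ _ hα₂ hα₂c h61 U₀ P hInA _ hPair h162 hLan h137
  have hα₀P : α₀ ≤ cP := hα₀c.trans (min_le_left _ _)
  have hα₂P : α₂ ≤ cP := hα₂c.trans (min_le_left _ _)
  obtain ⟨hα3, hα4, h16, hd5, hsmall, hc₃, hside, h50, hC⟩ :=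
    hwin α₀ α₂ hα₀ (hα₀c.trans (min_le_right _ _)) hα₂.le (hα₂c.trans (min_le_right _ _))
  have hC₂' : 8 * (131072 * ((d : ℝ) + 1) ^ 2) * Real.exp (4 * (800 * ((d : ℝ) + 1) ^ 2 * ((d : ℝ) + 4)) * α₀) ≤ C₂ :=
    hC.trans hC₂
  -- the data
  set W : Site d → Fin d → 𝔸ˣ := P.2.1 with hW_def
  have hWu : ∀ x κ, W x κ ∈ unitaryUnits 𝔸 := P.2.2
  have hU₀ : ∀ x κ, U₀.1 x κ ∈ unitaryUnits 𝔸 := U₀.2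
  set A : Site d → Fin d → 𝔸 := mlogCfg i.k i.η i.Ω W with hA_def
  -- (1.41) and self-adjointness of the canonical exponent; `W = e^{iηA}` on the `E j`
  have h41 : ∀ j, j ≤ i.k → ∀ (y : Site d) (τ : Fin d), SideTouches (i.Ω j) y τ →
      W y τ = cfgExp i.η A y τ ∧ ‖A y τ‖ ≤ α₂ * ((L : ℝ) ^ j * i.η)⁻¹ := by
    intro j hj y τ hs
    obtain ⟨hexp, -, hbd⟩ := h162 j hj (y, τ) hs
    have hexp' : W y τ = cfgExp i.η (logCfg i.η W) y τ := hexp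
    have hbd' : ‖logCfg i.η W y τ‖ ≤ 1 * α₂ * ((L : ℝ) ^ j * i.η)⁻¹ := hbd
    have hAy : A y τ = logCfg i.η W y τ := mlogCfg_of_sideTouches i.η W hj hs
    refine ⟨?_, ?_⟩
    · rw [hexp']
      exact cfgExp_congr_at i.η hAy.symm
    · rw [hAy]
      simpa only [one_mul] using hbd'
  have hAsa : ∀ y τ, IsSelfAdjoint (A y τ) := by
    intro y τ
    by_cases hmem : ∃ j, j ≤ i.k ∧ SideTouches (i.Ω j) y τ
    · obtain ⟨j, hj, hs⟩ := hmem
      rw [hA_def, mlogCfg_of_sideTouches i.η W hj hs]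
      exact (h162 j hj (y, τ) hs).2.1
    · rw [hA_def, mlogCfg_of_not i.η W fun j hj hs => hmem ⟨j, hj, hs⟩]
      exact IsSelfAdjoint.zero 𝔸
  have hA0 : ∀ (y : Site d) (τ : Fin d), (∀ j, j ≤ i.k → ¬ SideTouches (i.Ω j) y τ) → A y τ = 0 :=
    fun y τ h => mlogCfg_of_not i.η W h
  -- (1.40)₁ for `e^{iηA}U₀` by locality; the Landau clause for `e^{iηA}` by locality
  have h40₁ : InAk L i.k i.η α₀ i.Ω (mulCfg (expCfg (iEta i.η A)) U₀.1) := by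
    refine (inAk_congr_of_sideTouches L i.k i.η α₀ (V := mulCfg W U₀.1) fun j hj y τ hs => ?_).1 hPair
    show W y τ * U₀.1 y τ = expCfg (iEta i.η A) y τ * U₀.1 y τ
    rw [(h41 j hj y τ hs).1, expCfg_iEta_eq_cfgExp]
  -- the global bound and the gradient datum (bounded family)
  have hAglob : ∀ y τ, ‖A y τ‖ ≤ α₂ * i.η⁻¹ := by
    intro y τ
    by_cases hmem : ∃ j, j ≤ i.k ∧ SideTouches (i.Ω j) y τ
    · obtain ⟨j, hj, hs⟩ := hmem
      have hLj : (1 : ℝ) ≤ (L : ℝ) ^ j := one_le_pow₀ hLr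
      have hη0 : 0 < i.η := i.hη
      calc ‖A y τ‖ ≤ α₂ * ((L : ℝ) ^ j * i.η)⁻¹ := (h41 j hj y τ hs).2
        _ = α₂ * i.η⁻¹ * ((L : ℝ) ^ j)⁻¹ := by rw [mul_inv]; ring
        _ ≤ α₂ * i.η⁻¹ * 1 := by
            apply mul_le_mul_of_nonneg_left (inv_le_one_of_one_le₀ hLj) (by positivity)
        _ = α₂ * i.η⁻¹ := mul_one _
    · rw [hA0 y τ fun j hj hs => hmem ⟨j, hj, hs⟩, norm_zero]
      have hη0 : 0 < i.η := i.hη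
      positivity
  have hU₀1 : ∀ x κ, U₀.1 x κ ∈ U1 𝔸 := fun x κ => unitaryUnits_le_U1 (hU₀ x κ)
  have hgrad : ∀ (y : Site d) (κ τ : Fin d), ‖covDerivFwd i.η U₀.1 κ (fun z => A z τ) y‖ ≤ 2 * α₂ * i.η⁻¹ * i.η⁻¹ := by
    intro y κ τ
    have hη0 : 0 < i.η := i.hη
    unfold covDerivFwd
    rw [norm_smul, norm_inv, Real.norm_eq_abs, abs_of_pos hη0]
    have h1 : ‖B7Eq78Linearization.conjR (U₀.1 y κ) (A (y + e κ) τ) - A y τ‖ ≤ α₂ * i.η⁻¹ + α₂ * i.η⁻¹ := by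
      calc ‖B7Eq78Linearization.conjR (U₀.1 y κ) (A (y + e κ) τ) - A y τ‖
          ≤ ‖B7Eq78Linearization.conjR (U₀.1 y κ) (A (y + e κ) τ)‖ + ‖A y τ‖ := norm_sub_le _ _
        _ ≤ α₂ * i.η⁻¹ + α₂ * i.η⁻¹ := by
            rw [B8Ineq132.norm_conjR (hU₀1 y κ)]
            exact add_le_add (hAglob _ _) (hAglob _ _)
    calc i.η⁻¹ * ‖B7Eq78Linearization.conjR (U₀.1 y κ) (A (y + e κ) τ) - A y τ‖ ≤ i.η⁻¹ * (α₂ * i.η⁻¹ + α₂ * i.η⁻¹) :=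
        mul_le_mul_of_nonneg_left h1 (by positivity)
      _ = 2 * α₂ * i.η⁻¹ * i.η⁻¹ := by ring
  have hBg : Bdd L i.k i.η (-(2 : ℝ)) (fun j (t : Fin d × Fin d × Site d) => SideTouches (i.Ω j) t.2.2 t.2.1)
      (fun t => covDerivFwd i.η U₀.1 t.1 (fun z => A z t.2.1) t.2.2) := by
    have e2 : (-(2 : ℝ)) = -((2 : ℕ) : ℝ) := by norm_num
    rw [e2]
    refine B8ScaledSupNorm.bdd_of_forall (c := 2 * α₂ * ((L : ℝ) ^ i.k) ^ 2) fun j hj t _ => ?_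
    rw [B8ScaledSupNorm.weight_neg_natCast L i.η 2 j]
    have hLjk : (L : ℝ) ^ j ≤ (L : ℝ) ^ i.k := pow_le_pow_right₀ hLr hj
    have hLj0 : (0 : ℝ) ≤ (L : ℝ) ^ j := by positivity
    have hη0 : 0 < i.η := i.hη
    calc ((L : ℝ) ^ j * i.η) ^ 2 * ‖covDerivFwd i.η U₀.1 t.1 (fun z => A z t.2.1) t.2.2‖
        ≤ ((L : ℝ) ^ j * i.η) ^ 2 * (2 * α₂ * i.η⁻¹ * i.η⁻¹) := mul_le_mul_of_nonneg_left (hgrad _ _ _) (by positivity)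
      _ = 2 * α₂ * ((L : ℝ) ^ j) ^ 2 := by field_simp
      _ ≤ 2 * α₂ * ((L : ℝ) ^ i.k) ^ 2 := by gcongr
  set g : ℝ := msup L i.k i.η (-(2 : ℝ)) (fun j (t : Fin d × Fin d × Site d) => SideTouches (i.Ω j) t.2.2 t.2.1)
      (fun t => covDerivFwd i.η U₀.1 t.1 (fun z => A z t.2.1) t.2.2) with hg_def
  have hg0 : 0 ≤ g := B8ScaledSupNorm.msup_nonneg L i.k i.hη.le _ _ _
  have hg : ∀ j, j ≤ i.k → ∀ (y : Site d) (κ τ : Fin d), SideTouches (i.Ω j) y τ →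
      ((L : ℝ) ^ j * i.η) ^ 2 * ‖covDerivFwd i.η U₀.1 κ (fun z => A z τ) y‖ ≤ g := by
    intro j hj y κ τ hs
    have h := B8ScaledSupNorm.weight_mul_norm_le_msup hBg hj (i := (κ, τ, y)) hs
    have hw : weight L i.η (-(2 : ℝ)) j = ((L : ℝ) ^ j * i.η) ^ 2 := by
      have e2 : (-(2 : ℝ)) = -((2 : ℕ) : ℝ) := by norm_num
      rw [e2, B8ScaledSupNorm.weight_neg_natCast L i.η 2 j]
    rw [hw] at h
    exact h
  -- the Landau clause for `e^{iηA}` and the in-edge (1.59), five lines, from the socket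
  have hLanA : IsLandau138W L i.k i.η (i.Ω 0) (i.Λs i.k) U₀.1 W := hLan
  obtain ⟨h59a, h59g, h59j, h59l, h59h⟩ := SB9 α₀ α₂ hα₀ hα₀P hα₂ hα₂P U₀.1 W hU₀ hWu hInA hPair hLanA A hAsa h41 hA0
  -- (1.42) = the member's (1.37) clause, on the classified constraint bonds of the top truncation
  have hbox : ∀ j, j ≤ i.k → ∀ c ∈ i.Λb i.k j, ∀ x, InBox (loK L j c.1) (bondHiK L j c.1 c.2) x → x ∈ i.Ω j :=
    fun j hj c hc x hx => i.hbox i.k le_rfl j hj c hc x hx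
  have h42 : ∀ j, j ≤ i.k → ∀ c ∈ i.Λb i.k j, ‖logCovIter L U₀.1 (iEta i.η A) j c.1 c.2‖ < 2 * d * L * α₁ := h137
  have h41' : ∀ j, j ≤ i.k → ∀ (y : Site d) (τ : Fin d), SideTouches (i.Ω j) y τ → ‖A y τ‖ ≤ α₂ * ((L : ℝ) ^ j * i.η)⁻¹ :=
    fun j hj y τ hs => (h41 j hj y τ hs).2
  -- PROPOSITION 3 at `k` levels (n05-b), all four members, and the Hölder member
  obtain ⟨ha, hg', hj, hl⟩ := B8Prop3KLevel.prop3_norms_kLevel hd2 i.hη hL hU₀ hAsa hα₀ hα₁.le hα₂.le hg0 hα3 hα4 h16 hd5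
    hsmall hc₃ hB₀ hside h50 hC₂' h61 hbox hInA h40₁ h41' hg h42 h59a h59g h59j h59l
  have hh := B8Prop3KLevel.prop3_fifth_kLevel hd2 i.hη hL hU₀ hAsa hα₀ hα₁.le hα₂.le hg0 hα3 hα4 h16 hd5 hsmall hc₃ hB₀ hB₀β
    hside h50 hC₂' h61 hbox hInA h40₁ h41' hg h42 h59g h59h
  refine ⟨⟨fun j hj b hb => ?_, hg', hh⟩, hj, hl⟩
  -- (1.36)₁ pointwise on the `E j`, read on the logarithm
  obtain ⟨hexp, hsa, -⟩ := h162 j hj b hb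
  refine ⟨hexp, hsa, ?_⟩
  have hpt := B8Thm2GaugeFixedKLevel.thm2_pointwise_A i.hη hL1 h41' ha hj (y := b.1) (τ := b.2) hb
  rw [← mlogCfg_of_sideTouches i.η W hj hb]
  exact hpt

/-- **`B8.Prop3Printed` ON AN INDEX-MAPPED SUB-FAMILY `fam₂ ∘ ι`** of `zdGF3` from the Prop.-3-frame b9 socket on the image of `ι` only.
[cite: Balaban1985RegularSpaces, Prop. 3 p.87, (1.59) p.86] -/
theorem prop3Printed_zd3_map (hd2 : 2 ≤ d) {L : ℕ} (hL : 2 ≤ L) (inp : B8.B9Inputs) {B₀β C₂ cP : ℝ} (hB₀β : 0 ≤ B₀β)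
    (hC₂ : 2097152 * ((d : ℝ) + 1) ^ 2 ≤ C₂) (hcP : 0 < cP) (β : ℝ) (len : Site d → ℝ)
    {J : Type} (ι : J → ZdIdx d L)
    (SB9 : ∀ j : J, SockB9P3 (𝔸 := 𝔸) L inp.B₀ B₀β cP β len (ι j).η (ι j).k (ι j).Ω (ι j).Λs (ι j).Λb) :
    B8.Prop3Printed d (L : ℝ) C₂ inp B₀β (fun j : J => (zdGF3 𝔸 L β len (ι j)).toGFData2) := by
  obtain ⟨c, hc, H⟩ := prop3Body_member_zd3 (𝔸 := 𝔸) hd2 hL inp hB₀β hC₂ hcP β len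
  exact ⟨c, hc, fun j => H (ι j) (SB9 j) ()⟩

end Prop3

/-! ## §2 Theorem 2 ((1.66)₁-typed and as printed) on an index-mapped sub-family with `Ω₀ = ℤᵈ`, from the printed sentences as hypotheses -/

section Thm2

variable {𝔸 : Type} [CStarAlgebra 𝔸] [Nontrivial 𝔸]

/-- **THEOREM 2 (p. 83), (1.66)₁-typed, on an INDEX-MAPPED sub-family of `zdGF3` with `Ω₀ = ℤᵈ`, FROM THEOREM 4 AND PROPOSITION 3 AS
HYPOTHESES** — the assembly of `B8LeafModelZd3Thm2.thm2Printed_zd3_univ` (Theorem 4 at the (1.65)-shifted pair, Proposition 3 at `α₂ = c⋆″`,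
(1.42) at `α₁`, (1.66)₀ on all bonds by `B8Ineq166Univ`), generic over an index map `ι : J → ZdIdx d L` with `(ι j).Ω 0 = univ`, taking
`H4 : B8.Thm4Printed (5dLB₀) (fam₃ ∘ ι)` and `H3 : B8.Prop3Printed d L (2097152(d+1)²) ⟨B₀, B₀′⟩ B₀β (fam₂ ∘ ι)` as hypotheses over the
SAME index `J` (any provider chain feeds them; `J := {i // i.Ω 0 = univ}`, `ι := Subtype.val` is the statement of record).  Constants
`B₁ = 5dLB₀(1 + 11d²)`, `B₂ = 5dL·B₀β·(1 + 11d²)`.  Proof = the landed one verbatim (`i.1 ↦ ι i`, `i.2 ↦ hΩ i`).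
[cite: Balaban1985RegularSpaces, Thm 2 p.83, Thm 4 p.88, Prop. 3 p.87, (1.65)–(1.66) p.87, (1.42) p.83] -/
theorem thm2Printed_zd3_map_of_thm4 (hd2 : 2 ≤ d) {L : ℕ} (hL : 2 ≤ L) {β : ℝ} {len : Site d → ℝ}
    {B₀ B₀' B₀β : ℝ} (hB₀ : 0 < B₀) (hB₀' : 0 < B₀') (hB₀β : 0 < B₀β) (hB : 2 ≤ 5 * (d : ℝ) * L * B₀)
    {J : Type} (ι : J → ZdIdx d L) (hΩ : ∀ j, (ι j).Ω 0 = Set.univ)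
    (H4 : B8.Thm4Printed (5 * (d : ℝ) * L * B₀) (fun j : J => (zdGF3 𝔸 L β len (ι j)).toGFData))
    (H3 : B8.Prop3Printed d (L : ℝ) (2097152 * ((d : ℝ) + 1) ^ 2) ⟨B₀, B₀', hB₀, hB₀'⟩ B₀β
      (fun j : J => (zdGF3 𝔸 L β len (ι j)).toGFData2)) :
    B8.Thm2Printed (fun j : J => (zdGF3 𝔸 L β len (ι j)).toGFData) := by
  have hL1 : 1 ≤ L := le_trans (by norm_num) hL
  have hd1 : 1 ≤ d := le_trans (by norm_num) hd2
  have hL' : (1 : ℝ) ≤ L := by exact_mod_cast hL1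
  have hd' : (1 : ℝ) ≤ d := by exact_mod_cast hd1
  -- the two instances, the windows
  obtain ⟨c4, hc4, H4⟩ := H4
  let inp : B8.B9Inputs := ⟨B₀, B₀', hB₀, hB₀'⟩
  obtain ⟨c3, hc3, H3⟩ := H3
  obtain ⟨cw, hcw, hw⟩ := thm4_windows hd1 hL1 hB₀ hB₀' hB
  obtain ⟨cw', hcw', hw'⟩ := thm4_windows_extra (d := d) hL1
  -- constants
  set D : ℝ := 1 + 11 * (d : ℝ) ^ 2 with hD_def
  have hD1 : 1 ≤ D := le_add_of_nonneg_right (by positivity)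
  have hD0 : 0 < D := lt_of_lt_of_le one_pos hD1
  have hDne : D ≠ 0 := hD0.ne'
  have hK₁ : 0 < 5 * (d : ℝ) * L * B₀ := by positivity
  have hK₂ : 0 < 5 * (d : ℝ) * L * B₀β := by positivity
  set B₁ : ℝ := 5 * (d : ℝ) * L * B₀ * D with hB₁_def
  set B₂ : ℝ := 5 * (d : ℝ) * L * B₀β * D with hB₂_def
  have hB₁0 : 0 < B₁ := mul_pos hK₁ hD0
  have hB₂0 : 0 < B₂ := mul_pos hK₂ hD0
  have hK₁D : 0 < 5 * (d : ℝ) * L * B₀ * D := mul_pos hK₁ hD0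
  have hK₁Dne : 5 * (d : ℝ) * L * B₀ * D ≠ 0 := hK₁D.ne'
  -- the threshold: the shifted pair must fit every window; Prop 3's three smallness conditions; the (1.65) window
  set cT : ℝ := min (min (c4 / D) (min (cw / D) (cw' / D)))
    (min (min (c3 / D) (c3 / (5 * (d : ℝ) * L * B₀ * D))) (1 / (6 * D))) with hcT_def
  have hcT : 0 < cT :=
    lt_min (lt_min (div_pos hc4 hD0) (lt_min (div_pos hcw hD0) (div_pos hcw' hD0)))
      (lt_min (lt_min (div_pos hc3 hD0) (div_pos hc3 hK₁D)) (by positivity))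
  refine ⟨B₁, B₂, cT, hB₁0, hB₂0, hcT, ?_⟩
  intro i α₀ α₁ hα₀ hα₁ hs U₀ P hInA hReg hInAAx havg
  have hS0 : 0 < α₀ + α₁ := add_pos hα₀ hα₁
  -- unpack the thresholds
  have hle : ∀ {c : ℝ}, cT ≤ c / D → D * (α₀ + α₁) ≤ c := by
    intro c hc
    have h1 : α₀ + α₁ ≤ c / D := hs.trans hc
    calc D * (α₀ + α₁) ≤ D * (c / D) := mul_le_mul_of_nonneg_left h1 hD0.le
      _ = c := by field_simp
  have hs4 : D * (α₀ + α₁) ≤ c4 := hle ((min_le_left _ _).trans (min_le_left _ _))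
  have hsw : D * (α₀ + α₁) ≤ cw := hle ((min_le_left _ _).trans ((min_le_right _ _).trans (min_le_left _ _)))
  have hsw' : D * (α₀ + α₁) ≤ cw' := hle ((min_le_left _ _).trans ((min_le_right _ _).trans (min_le_right _ _)))
  have hs3 : D * (α₀ + α₁) ≤ c3 := hle ((min_le_right _ _).trans ((min_le_left _ _).trans (min_le_left _ _)))
  have hs3' : 5 * (d : ℝ) * L * B₀ * D * (α₀ + α₁) ≤ c3 := by
    have h1 : α₀ + α₁ ≤ c3 / (5 * (d : ℝ) * L * B₀ * D) :=
      hs.trans ((min_le_right _ _).trans ((min_le_left _ _).trans (min_le_right _ _)))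
    calc 5 * (d : ℝ) * L * B₀ * D * (α₀ + α₁) ≤ 5 * (d : ℝ) * L * B₀ * D * (c3 / (5 * (d : ℝ) * L * B₀ * D)) :=
        mul_le_mul_of_nonneg_left h1 hK₁D.le
      _ = c3 := by field_simp
  have hs6 : D * (α₀ + α₁) ≤ 1 / 6 := by
    have h1 : α₀ + α₁ ≤ 1 / (6 * D) := hs.trans ((min_le_right _ _).trans (min_le_right _ _))
    calc D * (α₀ + α₁) ≤ D * (1 / (6 * D)) := mul_le_mul_of_nonneg_left h1 hD0.le
      _ = 1 / 6 := by field_simp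
  -- the shifted pair `(α₀, α″)`
  set α'' : ℝ := 11 * (d : ℝ) ^ 2 * (α₀ + α₁) + α₁ with hα''_def
  have h11 : 0 ≤ 11 * (d : ℝ) ^ 2 * (α₀ + α₁) := by positivity
  have h11' : 0 ≤ 11 * (d : ℝ) ^ 2 * α₁ := by positivity
  have hα'' : 0 < α'' := by rw [hα''_def]; linarith only [h11, hα₁]
  have hsum : α₀ + α'' = D * (α₀ + α₁) := by simp only [hα''_def, hD_def]; ring
  have hα₁'' : α₁ ≤ α'' := by rw [hα''_def]; linarith only [h11]
  have h165 : 11 * (d : ℝ) ^ 2 * α₀ + α₁ ≤ α'' := by rw [hα''_def]; linarith only [h11']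
  -- windows at the shifted pair
  obtain ⟨-, -, -, -, w5, w6, w7, w8, w9, w10, w11, w12, -, w14, -, -, -, -⟩ :=
    hw α₀ α'' hα₀ hα'' (hsum ▸ hsw) (5 * (d : ℝ) * L * B₀ * (α₀ + α'')) (8 * B₀' * (5 * (d : ℝ) * L * B₀) * (α₀ + α'')) rfl rfl
  obtain ⟨w19, -⟩ := hw' α₀ α'' hα₀ hα'' (hsum ▸ hsw')
  have hsmall₁ : (d : ℝ) * L * α₁ ≤ 1 / 8 := (mul_le_mul_of_nonneg_left hα₁'' (by positivity)).trans w19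
  have hα2 : 2 * α₀ ≤ c2' d L := by linarith only [w6, hα₀]
  -- the data
  obtain ⟨hP1, h34, hAx⟩ := hInAAx
  subst hP1
  -- (1.66)₀ on all bonds (Ω₀ = ℤᵈ): (1.65)
  have hpart' : ∀ x : Site d, ∃ j, j ≤ (ι i).k ∧ ∃ y ∈ (ι i).Λs (ι i).k j, InBox (tlo L y j) (thi L y j) x := by
    intro x
    have hx : x ∈ (ι i).Ω 0 := by rw [hΩ i]; trivial
    exact (ι i).hpart x hx
  have hsm : 11 * (d : ℝ) ^ 2 * α₀ + α₁ ≤ 1 / 6 := by linarith only [h165, hα₀, hsum, hs6]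
  have h66 : ∀ b ∈ {b : Site d × Fin d | SideTouches ((ι i).Ω 0) b.1 b.2}, ‖((P.2.1 b.1 b.2 : 𝔸ˣ) : 𝔸) - 1‖ ≤ α'' := by
    intro b _
    have h := norm_pert_sub_one_le_univ hd1 hL (ι i).k (η := (ι i).η) P.1.2 P.2.2 hα₀ w5 hα2 hα₁.le hsm
      (ι i).Ω (ι i).hΩ ((ι i).Λs (ι i).k) (ι i).htower hpart' hInA h34 (hAx (ι i).k le_rfl) havg b.1 b.2
    exact h.trans h165
  have h166 : (zdGF3 𝔸 L β len (ι i)).avgClose166 α'' P.1 P :=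
    ⟨fun j hj z μ hb => (havg j hj z μ hb).trans hα₁'', h66⟩
  -- THEOREM 4 at the shifted pair
  obtain ⟨u, hR, ⟨h137'', hLan, h162⟩, huniq⟩ :=
    H4 i α₀ α'' hα₀ hα'' (hsum ▸ hs4) P.1 P hInA hReg ⟨rfl, h34, hAx⟩ h166
  -- (1.37) at the ORIGINAL α₁: the (1.42) lemma on the canonical exponent of the gauge-fixed field
  have hcs0 : 0 ≤ 5 * (d : ℝ) * L * B₀ * (α₀ + α'') := by positivity
  have hKS0 : 0 ≤ 2 * (L * (5 * (d : ℝ) * L * B₀ * (α₀ + α''))) + 8 * (8 * B₀' * (5 * (d : ℝ) * L * B₀) * (α₀ + α'')) := by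
    positivity
  have hcK : 5 * (d : ℝ) * L * B₀ * (α₀ + α'') ≤
      2 * (L * (5 * (d : ℝ) * L * B₀ * (α₀ + α''))) + 8 * (8 * B₀' * (5 * (d : ℝ) * L * B₀) * (α₀ + α'')) := by
    have h₁ : (1 : ℝ) * (5 * (d : ℝ) * L * B₀ * (α₀ + α'')) ≤ L * (5 * (d : ℝ) * L * B₀ * (α₀ + α'')) :=
      mul_le_mul_of_nonneg_right hL' hcs0
    have h₂ : 0 ≤ 8 * (8 * B₀' * (5 * (d : ℝ) * L * B₀) * (α₀ + α'')) := by positivity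
    linarith only [h₁, h₂, hcs0]
  have hc16 : 16 * (5 * (d : ℝ) * L * B₀ * (α₀ + α'')) ≤ 1 := by linarith only [w7, hcK, hKS0]
  have hu : ∀ x, u.1 x ∈ unitaryUnits 𝔸 := u.2.1
  have hW : mgauge P.1.1 u.1 (mgauge P.1.1 u.1⁻¹ P.2.1) = P.2.1 := mgauge_mgauge_inv P.1.1 P.2.1 u.1
  have hWu : ∀ x κ, mgauge P.1.1 u.1⁻¹ P.2.1 x κ ∈ unitaryUnits 𝔸 := mem_unitaryUnits_of_mgauge_eq P.1.2 P.2.2 hu hW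
  have hWA : ∀ j, j ≤ (ι i).k → ∀ y τ, SideTouches ((ι i).Ω j) y τ →
      mgauge P.1.1 u.1⁻¹ P.2.1 y τ = cfgExp (ι i).η (logCfg (ι i).η (mgauge P.1.1 u.1⁻¹ P.2.1)) y τ ∧
        ‖logCfg (ι i).η (mgauge P.1.1 u.1⁻¹ P.2.1) y τ‖ ≤ (5 * (d : ℝ) * L * B₀ * (α₀ + α'')) * ((L : ℝ) ^ j * (ι i).η)⁻¹ :=
    fun j hj y τ h => ⟨(h162 j hj (y, τ) h).1, (h162 j hj (y, τ) h).2.2⟩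
  obtain ⟨hA'sa, hA'eq, hA'zero⟩ := mlogCfg_spec (ι i).hη hL1 (ι i).k P.1.1 hWu hcs0 hc16 (ι i).Ω hWA
  set A' := mlogCfg (ι i).k (ι i).η (ι i).Ω (mgauge P.1.1 u.1⁻¹ P.2.1) with hA'_def
  have hA'bd : ∀ j, j ≤ (ι i).k → ∀ y τ, SideTouches ((ι i).Ω j) y τ →
      mgauge P.1.1 u.1⁻¹ P.2.1 y τ = cfgExp (ι i).η A' y τ ∧
        ‖A' y τ‖ ≤ (2 * (L * (5 * (d : ℝ) * L * B₀ * (α₀ + α''))) + 8 * (8 * B₀' * (5 * (d : ℝ) * L * B₀) * (α₀ + α''))) *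
          ((L : ℝ) ^ j * (ι i).η)⁻¹ := by
    intro j hj y τ h
    obtain ⟨hAA, hWexp⟩ := hA'eq j hj y τ h
    refine ⟨hWexp, ?_⟩
    rw [hAA]
    have hη0 : 0 ≤ (ι i).η := (ι i).hη.le
    exact ((hWA j hj y τ h).2).trans (mul_le_mul_of_nonneg_right hcK (by positivity))
  have h137 : (zdGF3 𝔸 L β len (ι i)).C137 α₁ P.1 ((zdGF3 𝔸 L β len (ι i)).act P u) :=
    B8Eq142KLevelLocal.H42_of_inAx hd2 (ι i).hη hL (ι i).k P.1.2 hα₀ hα₁ hKS0 w5 w6 w7 w9 w10 hsmall₁ (ι i).Ω (ι i).hΩ (ι i).Λs (ι i).Λb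
      (ι i).hbox (ι i).hclass hInA h34 hAx havg (fun m W => IsLandau138W L m (ι i).η ((ι i).Ω 0) ((ι i).Λs m) P.1.1 W) (ι i).k (ι i).hk le_rfl u.1
      (mgauge P.1.1 u.1⁻¹ P.2.1) A' hu hW hR hLan hA'sa hA'bd hA'zero
  -- PROPOSITION 3 at (α₀, α″, α₂ := c⋆″) for the gauge-fixed field
  have hSD : α₀ + α₁ ≤ D * (α₀ + α₁) := le_mul_of_one_le_left hS0.le hD1
  have hα₀3 : α₀ ≤ c3 := by linarith only [hα₁, hSD, hs3]
  have hα''3 : α'' ≤ c3 := by linarith only [hα₀, hsum, hs3]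
  have hcs3 : 5 * (d : ℝ) * L * B₀ * (α₀ + α'') ≤ c3 := by
    rw [hsum, ← mul_assoc]; exact hs3'
  have hcspos : 0 < 5 * (d : ℝ) * L * B₀ * (α₀ + α'') := by positivity
  have h61 : 2 * (5 * (d : ℝ) * L * B₀ * (α₀ + α'')) ^ 2 + 20 * d * α₀ * (5 * (d : ℝ) * L * B₀ * (α₀ + α'')) +
      2 * (2097152 * ((d : ℝ) + 1) ^ 2) * (5 * (d : ℝ) * L * B₀ * (α₀ + α'')) ^ 2 ≤ α₀ + α'' := by
    set c := 5 * (d : ℝ) * L * B₀ * (α₀ + α'') with hc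
    set K := 2 * (L * c) + 8 * (8 * B₀' * (5 * (d : ℝ) * L * B₀) * (α₀ + α'')) with hK
    have hcKle : c ≤ K := hcK
    have hc0 : 0 ≤ c := hcs0
    have hC : (2 : ℝ) * (16 * (131072 * ((d : ℝ) + 1) ^ 2)) = 2 * (2097152 * ((d : ℝ) + 1) ^ 2) := by ring
    rw [← hC]
    have hmono : 2 * c ^ 2 + 20 * d * α₀ * c + 2 * (16 * (131072 * ((d : ℝ) + 1) ^ 2)) * c ^ 2 ≤
        2 * K ^ 2 + 20 * d * α₀ * K + 2 * (16 * (131072 * ((d : ℝ) + 1) ^ 2)) * K ^ 2 := by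
      have h1 : c ^ 2 ≤ K ^ 2 := pow_le_pow_left₀ hc0 hcKle 2
      have h2 : 0 ≤ 20 * (d : ℝ) * α₀ := by positivity
      have h3 : 0 ≤ 2 * (16 * (131072 * ((d : ℝ) + 1) ^ 2)) := by positivity
      have h4 := mul_le_mul_of_nonneg_left hcKle h2
      have h5 := mul_le_mul_of_nonneg_left h1 h3
      linarith only [h1, h4, h5]
    exact hmono.trans w14
  have hPair : (zdGF3 𝔸 L β len (ι i)).InAPair α₀ P.1 ((zdGF3 𝔸 L β len (ι i)).act P u) := by
    show InAk L (ι i).k (ι i).η α₀ (ι i).Ω (mulCfg (mgauge P.1.1 u.1⁻¹ P.2.1) P.1.1)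
    have hui : ∀ x, u.1⁻¹ x ∈ U1 𝔸 := fun x => unitaryUnits_le_U1 ((unitaryUnits 𝔸).inv_mem (hu x))
    rw [mulCfg_eq_gaugeAct_of_mgauge_eq hW]
    exact (B8Ineq132.inAk_gaugeAct_iff L (ι i).k (ι i).η α₀ (ι i).Ω hui _).2 h34
  have h162' : (zdGF3 𝔸 L β len (ι i)).C162 1 (5 * (d : ℝ) * L * B₀ * (α₀ + α'')) P.1 ((zdGF3 𝔸 L β len (ι i)).act P u) := by
    intro j hj b hb
    obtain ⟨h1, h2, h3⟩ := h162 j hj b hb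
    exact ⟨h1, h2, by rw [one_mul]; exact h3⟩
  obtain ⟨h136, h139⟩ := H3 i α₀ α'' (5 * (d : ℝ) * L * B₀ * (α₀ + α'')) hα₀ hα₀3 hα'' hα''3 hcspos hcs3 h61 P.1
    ((zdGF3 𝔸 L β len (ι i)).act P u) hInA hReg hPair h162' hLan h137''
  -- constants: `5dLB₀(α₀ + α″) = B₁(α₀ + α₁)`, `5dL·B₀β·(α₀ + α″) = B₂(α₀ + α₁)`
  have e1 : 5 * (d : ℝ) * (L : ℝ) * inp.B₀ * (α₀ + α'') = B₁ * (α₀ + α₁) := by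
    show 5 * (d : ℝ) * (L : ℝ) * B₀ * (α₀ + α'') = B₁ * (α₀ + α₁)
    rw [hsum, hB₁_def]; ring
  have e2 : 5 * (d : ℝ) * (L : ℝ) * B₀β * (α₀ + α'') = B₂ * (α₀ + α₁) := by rw [hsum, hB₂_def]; ring
  obtain ⟨h136a, h136g, h136h⟩ := h136
  obtain ⟨h139j, h139l⟩ := h139
  refine ⟨u, hR, ⟨⟨fun j hj b hb => ?_, by rw [← e1]; exact h136g, by rw [← e2]; exact h136h⟩, h137, hLan,
    ⟨by rw [← e1]; exact h139j, by rw [← e1]; exact h139l⟩⟩, ?_⟩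
  · obtain ⟨h1, h2, h3⟩ := h136a j hj b hb
    exact ⟨h1, h2, by rw [← e1]; exact h3⟩
  -- uniqueness: Theorem 4's, since (1.36) at `B₁(α₀ + α₁) = B₁′(α₀ + α″)` is (1.62) there and (1.37) is monotone in α₁
  · intro u' hR' h136' h137' hLan' _
    refine huniq u' hR' ?_ hLan' ?_
    · intro j hj c hc
      have hmono : 2 * (d : ℝ) * L * α₁ ≤ 2 * d * L * α'' := mul_le_mul_of_nonneg_left hα₁'' (by positivity)
      exact (h137' j hj c hc).trans_le hmono
    · intro j hj b hb
      obtain ⟨h1, h2, h3⟩ := h136'.1 j hj b hb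
      refine ⟨h1, h2, ?_⟩
      have e1' : B₁ * (α₀ + α₁) = 5 * (d : ℝ) * L * B₀ * (α₀ + α'') := by rw [hsum, hB₁_def]; ring
      rw [← e1']
      exact h3

/-- **THEOREM 2 AS PRINTED — (1.35) ON THE LAYERS — on an INDEX-MAPPED sub-family with `Ω₀ = ℤᵈ`, FROM THE (1.66)₁-TYPED THEOREM 2 AS A
HYPOTHESIS** — the assembly of `B8LeafModelZd3Thm2Of135.thm2_of135_zd3_univ` (chair R453 (C): (1.65) via `avgClose_zdGF3_of135` under the
index law №11 `h16`, the instance at `(α₀, α₁″ = 11d²α₀ + α₁)`, (1.37) at print's `α₁` by the (1.42) lemma in touching form), generic over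
ANY index map `ι : J → ZdIdx d L` (no `Ω₀ = ℤᵈ` clause is read at this stage: it enters only through `H2`), taking `H2 : B8.Thm2Printed
(fam ∘ ι)`.  Proof = the landed one verbatim.
[cite: Balaban1985RegularSpaces, Thm 2 p.83, (1.33)–(1.37) p.82, (1.65)–(1.66) p.87, (1.42) p.83, (1.6) p.77] -/
theorem thm2_of135_zd3_map_of_thm2 (hd2 : 2 ≤ d) {L : ℕ} (hL : 2 ≤ L) {β : ℝ} {len : Site d → ℝ}
    {J : Type} (ι : J → ZdIdx d L)
    (H2 : B8.Thm2Printed (fun j : J => (zdGF3 𝔸 L β len (ι j)).toGFData)) :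
    ∃ B₁ B₂ c₁ : ℝ, 0 < B₁ ∧ 0 < B₂ ∧ 0 < c₁ ∧
      ∀ i : J,
        (∀ ℓ, ℓ ≤ (ι i).k → ∀ w : Site d, (∀ x, InBox (tlo L w ℓ) (thi L w ℓ) x → x ∈ (ι i).Ω ℓ) →
          ∃ j, ℓ ≤ j ∧ j ≤ (ι i).k ∧ ∃ y ∈ (ι i).Λs (ι i).k j, Under L (j - ℓ) y w) →
        ∀ α₀ α₁ : ℝ, 0 < α₀ → 0 < α₁ → α₀ + α₁ ≤ c₁ →
          ∀ (U₀ : (zdGF3 𝔸 L β len (ι i)).Cfg) (P : (zdGF3 𝔸 L β len (ι i)).Pert),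
            (zdGF3 𝔸 L β len (ι i)).InA α₀ U₀ → (zdGF3 𝔸 L β len (ι i)).Reg335 α₀ U₀ → (zdGF3 𝔸 L β len (ι i)).InAAx α₀ U₀ P →
            (∀ j, j ≤ (ι i).k → ∀ (z : Site d) (μ : Fin d), BondTouches ((ι i).Λs (ι i).k j) z μ →
              (∀ x, InBox (loK L j z) (bondHiK L j z μ) x → x ∈ (ι i).Ω j) →
              ‖(avgIter L (mulCfg P.2.1 U₀.1) j z μ : 𝔸) - (avgIter L U₀.1 j z μ : 𝔸)‖ ≤ α₁) →
            ∃ u : (zdGF3 𝔸 L β len (ι i)).GT, (zdGF3 𝔸 L β len (ι i)).Restricted U₀ u ∧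
              ((zdGF3 𝔸 L β len (ι i)).C136 B₁ B₂ (α₀ + (11 * (d : ℝ) ^ 2 * α₀ + α₁)) U₀ ((zdGF3 𝔸 L β len (ι i)).act P u) ∧
                (zdGF3 𝔸 L β len (ι i)).C137 α₁ U₀ ((zdGF3 𝔸 L β len (ι i)).act P u) ∧
                (zdGF3 𝔸 L β len (ι i)).Landau U₀ ((zdGF3 𝔸 L β len (ι i)).act P u) ∧
                (zdGF3 𝔸 L β len (ι i)).C139 B₁ (α₀ + (11 * (d : ℝ) ^ 2 * α₀ + α₁)) U₀ ((zdGF3 𝔸 L β len (ι i)).act P u)) ∧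
              ∀ u' : (zdGF3 𝔸 L β len (ι i)).GT, (zdGF3 𝔸 L β len (ι i)).Restricted U₀ u' →
                (zdGF3 𝔸 L β len (ι i)).C136 B₁ B₂ (α₀ + (11 * (d : ℝ) ^ 2 * α₀ + α₁)) U₀ ((zdGF3 𝔸 L β len (ι i)).act P u') →
                (zdGF3 𝔸 L β len (ι i)).C137 α₁ U₀ ((zdGF3 𝔸 L β len (ι i)).act P u') →
                (zdGF3 𝔸 L β len (ι i)).Landau U₀ ((zdGF3 𝔸 L β len (ι i)).act P u') →
                (zdGF3 𝔸 L β len (ι i)).C139 B₁ (α₀ + (11 * (d : ℝ) ^ 2 * α₀ + α₁)) U₀ ((zdGF3 𝔸 L β len (ι i)).act P u') →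
                  u' = u := by
  have hL1 : 1 ≤ L := le_trans (by norm_num) hL
  have hd1 : 1 ≤ d := le_trans (by norm_num) hd2
  have hd' : (1 : ℝ) ≤ d := by exact_mod_cast hd1
  have hL' : (1 : ℝ) ≤ L := by exact_mod_cast hL1
  -- the (1.66)₁-typed instance (t2 of record at the pin) and Prop. 3's window threshold
  obtain ⟨B₁, B₂, c₁, hB₁, hB₂, hc₁, H⟩ := H2
  obtain ⟨cN, hcN, hwin⟩ := prop3_windows hd2 hL (B₀ := 0) le_rfl
  -- constants and the threshold
  set D : ℝ := 1 + 11 * (d : ℝ) ^ 2 with hD_def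
  have hD1 : 1 ≤ D := le_add_of_nonneg_right (by positivity)
  have hD0 : 0 < D := lt_of_lt_of_le one_pos hD1
  have hB₁D : 0 < B₁ * D := mul_pos hB₁ hD0
  set cT : ℝ := min (min (c₁ / D) cN) (min (min (1 / (6 * D)) (cN / (B₁ * D))) (min (1 / (16 * (B₁ * D))) (1 / (8 * (d : ℝ) * L))))
    with hcT_def
  have hcT : 0 < cT :=
    lt_min (lt_min (div_pos hc₁ hD0) hcN) (lt_min (lt_min (by positivity) (div_pos hcN hB₁D)) (lt_min (by positivity) (by positivity)))
  refine ⟨B₁, B₂, cT, hB₁, hB₂, hcT, ?_⟩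
  intro i h16 α₀ α₁ hα₀ hα₁ hs U₀ P hInA hReg hInAAx h35
  have hS0 : 0 < α₀ + α₁ := add_pos hα₀ hα₁
  -- unpack the threshold
  have hsc₁ : α₀ + α₁ ≤ c₁ / D := hs.trans ((min_le_left _ _).trans (min_le_left _ _))
  have hsN : α₀ + α₁ ≤ cN := hs.trans ((min_le_left _ _).trans (min_le_right _ _))
  have hs6 : α₀ + α₁ ≤ 1 / (6 * D) := hs.trans ((min_le_right _ _).trans ((min_le_left _ _).trans (min_le_left _ _)))
  have hsNB : α₀ + α₁ ≤ cN / (B₁ * D) := hs.trans ((min_le_right _ _).trans ((min_le_left _ _).trans (min_le_right _ _)))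
  have hs16 : α₀ + α₁ ≤ 1 / (16 * (B₁ * D)) := hs.trans ((min_le_right _ _).trans ((min_le_right _ _).trans (min_le_left _ _)))
  have hs8 : α₀ + α₁ ≤ 1 / (8 * (d : ℝ) * L) := hs.trans ((min_le_right _ _).trans ((min_le_right _ _).trans (min_le_right _ _)))
  -- the shifted closeness constant `α₁″ = 11d²α₀ + α₁`
  set α₁'' : ℝ := 11 * (d : ℝ) ^ 2 * α₀ + α₁ with hα₁''_def
  have h11 : 0 ≤ 11 * (d : ℝ) ^ 2 * α₀ := by positivity
  have hα₁'' : 0 < α₁'' := by rw [hα₁''_def]; linarith only [h11, hα₁]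
  have hα₁le : α₁ ≤ α₁'' := by rw [hα₁''_def]; linarith only [h11]
  have hsum : α₀ + α₁'' ≤ D * (α₀ + α₁) := by
    have e : D * (α₀ + α₁) = α₀ + α₁'' + 11 * (d : ℝ) ^ 2 * α₁ := by rw [hD_def, hα₁''_def]; ring
    rw [e]; linarith only [show (0 : ℝ) ≤ 11 * (d : ℝ) ^ 2 * α₁ by positivity]
  have hsumc : α₀ + α₁'' ≤ c₁ := by
    have h := mul_le_mul_of_nonneg_left hsc₁ hD0.le
    rw [mul_div_cancel₀ _ hD0.ne'] at h
    exact hsum.trans h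
  -- the windows of (1.65) at `α₀`
  have hα₀N : α₀ ≤ cN := by linarith only [hsN, hα₁]
  obtain ⟨hα3, hα4, -, -, -, -, -, -, -⟩ := hwin α₀ α₀ hα₀ hα₀N hα₀.le hα₀N
  have hα2 : 2 * α₀ ≤ c2' d L := by linarith only [hα4, hα₀]
  have hsm : 11 * (d : ℝ) ^ 2 * α₀ + α₁ ≤ 1 / 6 := by
    have h := mul_le_mul_of_nonneg_left hs6 hD0.le
    have e : D * (1 / (6 * D)) = 1 / 6 := by field_simp
    rw [e] at h
    have : α₁'' ≤ α₀ + α₁'' := le_add_of_nonneg_left hα₀.le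
    linarith only [this, hsum, h]
  -- (1.65): the member's `avgClose` at `α₁″`
  have havg : (zdGF3 𝔸 L β len (ι i)).avgClose α₁'' U₀ P :=
    avgClose_zdGF3_of135 hd1 hL (ι i) h16 hα₀ hα3 hα2 hα₁.le hsm U₀ P hInA hInAAx h35
  -- the (1.66)₁-typed THEOREM 2 at `(α₀, α₁″)`
  obtain ⟨u, hR, ⟨h136, -, hLan, h139⟩, huniq⟩ := H i α₀ α₁'' hα₀ hα₁'' hsumc U₀ P hInA hReg hInAAx havg
  -- (1.37) at print's `α₁`, by the (1.42) lemma in touching form on the canonical masked logarithm of `U′^{u⁻¹}`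
  obtain ⟨hP1, h34, hAx⟩ := hInAAx
  subst hP1
  have hu : ∀ x, u.1 x ∈ unitaryUnits 𝔸 := u.2.1
  have hW : mgauge P.1.1 u.1 (mgauge P.1.1 u.1⁻¹ P.2.1) = P.2.1 := mgauge_mgauge_inv P.1.1 P.2.1 u.1
  have hWu : ∀ x κ, mgauge P.1.1 u.1⁻¹ P.2.1 x κ ∈ unitaryUnits 𝔸 := mem_unitaryUnits_of_mgauge_eq P.1.2 P.2.2 hu hW
  have hcs0 : 0 ≤ B₁ * (α₀ + α₁'') := by positivity
  have hα₂N : B₁ * (α₀ + α₁'') ≤ cN := by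
    have h := mul_le_mul_of_nonneg_left hsNB hB₁D.le
    rw [mul_div_cancel₀ _ hB₁D.ne'] at h
    calc B₁ * (α₀ + α₁'') ≤ B₁ * (D * (α₀ + α₁)) := mul_le_mul_of_nonneg_left hsum hB₁.le
      _ = B₁ * D * (α₀ + α₁) := by ring
      _ ≤ cN := h
  have hc16 : 16 * (B₁ * (α₀ + α₁'')) ≤ 1 := by
    have h := mul_le_mul_of_nonneg_left hs16 (show (0 : ℝ) ≤ 16 * (B₁ * D) by positivity)
    have e : 16 * (B₁ * D) * (1 / (16 * (B₁ * D))) = 1 := by field_simp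
    rw [e] at h
    calc 16 * (B₁ * (α₀ + α₁'')) ≤ 16 * (B₁ * (D * (α₀ + α₁))) := by gcongr
      _ = 16 * (B₁ * D) * (α₀ + α₁) := by ring
      _ ≤ 1 := h
  have hWA : ∀ j, j ≤ (ι i).k → ∀ y τ, SideTouches ((ι i).Ω j) y τ →
      mgauge P.1.1 u.1⁻¹ P.2.1 y τ = cfgExp (ι i).η (logCfg (ι i).η (mgauge P.1.1 u.1⁻¹ P.2.1)) y τ ∧
        ‖logCfg (ι i).η (mgauge P.1.1 u.1⁻¹ P.2.1) y τ‖ ≤ (B₁ * (α₀ + α₁'')) * ((L : ℝ) ^ j * (ι i).η)⁻¹ :=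
    fun j hj y τ h => ⟨(h136.1 j hj (y, τ) h).1, (h136.1 j hj (y, τ) h).2.2⟩
  obtain ⟨hA'sa, hA'eq, -⟩ := mlogCfg_spec (ι i).hη hL1 (ι i).k P.1.1 hWu hcs0 hc16 (ι i).Ω hWA
  set A' := mlogCfg (ι i).k (ι i).η (ι i).Ω (mgauge P.1.1 u.1⁻¹ P.2.1) with hA'_def
  have hA'bd : ∀ j, j ≤ (ι i).k → ∀ y τ, SideTouches ((ι i).Ω j) y τ →
      mgauge P.1.1 u.1⁻¹ P.2.1 y τ = cfgExp (ι i).η A' y τ ∧ ‖A' y τ‖ ≤ (B₁ * (α₀ + α₁'')) * ((L : ℝ) ^ j * (ι i).η)⁻¹ := by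
    intro j hj y τ h
    obtain ⟨hAA, hWexp⟩ := hA'eq j hj y τ h
    exact ⟨hWexp, by rw [hAA]; exact (hWA j hj y τ h).2⟩
  -- the windows of the (1.42) lemma at `α₂ := B₁(α₀ + α₁″)`
  obtain ⟨-, -, h16w, -, hsmallw, hc₃w, -, -, -⟩ := hwin α₀ (B₁ * (α₀ + α₁'')) hα₀ hα₀N hcs0 hα₂N
  have hsmall₁ : (d : ℝ) * L * α₁ ≤ 1 / 8 := by
    have h := mul_le_mul_of_nonneg_left hs8 (show (0 : ℝ) ≤ (d : ℝ) * L by positivity)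
    have e : (d : ℝ) * L * (1 / (8 * (d : ℝ) * L)) = 1 / 8 := by field_simp
    rw [e] at h
    have : (d : ℝ) * L * α₁ ≤ (d : ℝ) * L * (α₀ + α₁) := mul_le_mul_of_nonneg_left (by linarith only [hα₀]) (by positivity)
    exact this.trans h
  have h137 : (zdGF3 𝔸 L β len (ι i)).C137 α₁ P.1 ((zdGF3 𝔸 L β len (ι i)).act P u) :=
    H42_of_inAx_touching hd2 (ι i).hη hL (ι i).k P.1.2 hα₀ hα₁ hcs0 hα3 hα4 h16w hsmallw hc₃w hsmall₁ (ι i).Ω (ι i).hΩ ((ι i).Λs (ι i).k)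
      ((ι i).Λb (ι i).k) ((ι i).hbox (ι i).k le_rfl) ((ι i).hclass (ι i).k le_rfl) hInA h34 (hAx (ι i).k le_rfl) h35 u.1
      (mgauge P.1.1 u.1⁻¹ P.2.1) A' hu hW hR hA'sa hA'bd
  -- conclusion; uniqueness is the instance's, (1.37) being monotone in `α₁`
  refine ⟨u, hR, ⟨h136, h137, hLan, h139⟩, ?_⟩
  intro u' hR' h136' h137' hLan' h139'
  refine huniq u' hR' h136' ?_ hLan' h139'
  intro j hj c hc
  have hmono : 2 * (d : ℝ) * L * α₁ ≤ 2 * d * L * α₁'' := mul_le_mul_of_nonneg_left hα₁le (by positivity)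
  exact (h137' j hj c hc).trans_le hmono

end Thm2

#print axioms prop3Body_member_zd3
#print axioms prop3Printed_zd3_map
#print axioms thm2Printed_zd3_map_of_thm4
#print axioms thm2_of135_zd3_map_of_thm2

end Literature.MathematicalPhysics.QuantumFieldTheory.Balaban1983to89.B8LeafModelZd3Map

end
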